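import Mathlib.Analysis.SpecialFunctions.SmoothTransition
import Mathlib.Analysis.Calculus.Deriv.Mul
import Mathlib.Topology.Order.Compact
import HarnessLib

/-!
# Radial profile functions for the unwinding of the interior surgery map

Topic `Geometry/Riemannian` (elementary real analysis). The interior surgery map of Weinstein's
disk (Weinstein 1968, proof of the main theorem, step (3)) is written in polar-graph form
`F(ρ u) = R(ρ, u) Θ(ρ, u)`; between the collar (where `F` is the cone map) and the centre (where
`F = id`) two smooth radial profiles are used:

* the **step** `χ(ρ) = smoothTransition (3ρ - 1)`: `χ = 0` on `ρ ≤ 1/3`, `χ = 1` on `ρ ≥ 2/3`,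
  `0 ≤ χ ≤ 1`, smooth, with bounded derivative (`chi_*`, `exists_bound_deriv_chi`);
* the **soft clamp** `clamp_ε(ρ) = (1 - ε) + (ε/2) h((ρ - (1 - ε))/(ε/2))` built from
  `h(x) = x · smoothTransition x` (`h = 0` on `x ≤ 0`, `h = x` on `x ≥ 1`, monotone, smooth):
  `clamp_ε = 1 - ε` on `ρ ≤ 1 - ε`, `clamp_ε(ρ) = ρ` on `ρ ≥ 1 - ε/2`, monotone, values in
  `[1 - ε, max ρ (1 - ε)]`, smooth (`clamp_*`).

## References

* A. Weinstein, Ann. of Math. (2) 87 (1968), 29–41, proof of the main theorem, step (3).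
  [cite: Weinstein1968]

Tags: [SmoothTransition] [Weinstein1968]
-/

noncomputable section

open Set Function Real

namespace Literature.Geometry.Riemannian

/-! ### `h(x) = x · smoothTransition x` -/

/-- `h(x) = 0` for `x ≤ 0`. [folklore] -/
theorem mul_smoothTransition_of_nonpos {x : ℝ} (hx : x ≤ 0) : x * smoothTransition x = 0 := by
  rw [smoothTransition.zero_of_nonpos hx, mul_zero]

/-- `h(x) = x` for `1 ≤ x`. [folklore] -/
theorem mul_smoothTransition_of_one_le {x : ℝ} (hx : 1 ≤ x) : x * smoothTransition x = x := by
  rw [smoothTransition.one_of_one_le hx, mul_one]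

/-- `0 ≤ h(x)`. [folklore] -/
theorem mul_smoothTransition_nonneg (x : ℝ) : 0 ≤ x * smoothTransition x := by
  rcases le_or_gt x 0 with hx | hx
  · rw [mul_smoothTransition_of_nonpos hx]
  · exact mul_nonneg hx.le (smoothTransition.nonneg x)

/-- `h(x) ≤ x` for `0 ≤ x`. [folklore] -/
theorem mul_smoothTransition_le_self {x : ℝ} (hx : 0 ≤ x) : x * smoothTransition x ≤ x :=
  mul_le_of_le_one_right hx (smoothTransition.le_one x)

/-- `h` is monotone. [folklore] -/
theorem monotone_mul_smoothTransition : Monotone fun x : ℝ ↦ x * smoothTransition x := by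
  intro x y hxy
  rcases le_or_gt x 0 with hx | hx
  · simp only [mul_smoothTransition_of_nonpos hx]
    exact mul_smoothTransition_nonneg y
  · simp only
    exact mul_le_mul hxy (smoothTransition.monotone hxy) (smoothTransition.nonneg x)
      (hx.le.trans hxy)

/-- `h` is smooth. [folklore] -/
theorem contDiff_mul_smoothTransition {n : ℕ∞} : ContDiff ℝ n fun x : ℝ ↦ x * smoothTransition x :=
  contDiff_id.mul smoothTransition.contDiff

/-! ### The step `χ(ρ) = smoothTransition (3ρ - 1)` -/

/-- `χ = 0` on `ρ ≤ 1/3`. [folklore] -/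
theorem chi_eq_zero {ρ : ℝ} (hρ : ρ ≤ 1 / 3) : smoothTransition (3 * ρ - 1) = 0 :=
  smoothTransition.zero_of_nonpos (by linarith)

/-- `χ = 1` on `2/3 ≤ ρ`. [folklore] -/
theorem chi_eq_one {ρ : ℝ} (hρ : 2 / 3 ≤ ρ) : smoothTransition (3 * ρ - 1) = 1 :=
  smoothTransition.one_of_one_le (by linarith)

/-- `χ` is smooth. [folklore] -/
theorem contDiff_chi {n : ℕ∞} : ContDiff ℝ n fun ρ : ℝ ↦ smoothTransition (3 * ρ - 1) :=
  smoothTransition.contDiff.comp ((contDiff_const.mul contDiff_id).sub contDiff_const)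

/-- `χ` is monotone. [folklore] -/
theorem monotone_chi : Monotone fun ρ : ℝ ↦ smoothTransition (3 * ρ - 1) :=
  fun _ _ h ↦ smoothTransition.monotone (by linarith)

/-- **A continuous function which vanishes off a compact interval is bounded.** [folklore] -/
theorem exists_bound_of_continuous_of_eq_zero {f : ℝ → ℝ} (hf : Continuous f) {a b : ℝ}
    (h0 : ∀ x, x ∉ Icc a b → f x = 0) : ∃ C : ℝ, 0 ≤ C ∧ ∀ x, |f x| ≤ C := by
  obtain ⟨C, hC⟩ := isCompact_Icc.exists_bound_of_continuousOn (f := f) (s := Icc a b) hf.continuousOn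
  refine ⟨max C 0, le_max_right _ _, fun x ↦ ?_⟩
  by_cases hx : x ∈ Icc a b
  · exact ((Real.norm_eq_abs _).symm.le.trans (hC x hx)).trans (le_max_left _ _)
  · rw [h0 x hx, abs_zero]; exact le_max_right _ _

/-- **`χ'` is bounded.** [folklore] -/
theorem exists_bound_deriv_chi :
    ∃ C : ℝ, 0 ≤ C ∧ ∀ ρ, |deriv (fun ρ : ℝ ↦ smoothTransition (3 * ρ - 1)) ρ| ≤ C := by
  apply exists_bound_of_continuous_of_eq_zero
    ((contDiff_chi (n := 1)).continuous_deriv le_rfl) (a := 1 / 3) (b := 2 / 3)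
  intro x hx
  rw [mem_Icc, not_and_or, not_le, not_le] at hx
  -- `χ` is locally constant off `[1/3, 2/3]`
  rcases hx with hx | hx
  · have hev : (fun ρ : ℝ ↦ smoothTransition (3 * ρ - 1)) =ᶠ[nhds x] fun _ ↦ (0 : ℝ) := by
      filter_upwards [Iio_mem_nhds hx] with y hy
      exact chi_eq_zero (le_of_lt hy)
    rw [hev.deriv_eq, deriv_const]
  · have hev : (fun ρ : ℝ ↦ smoothTransition (3 * ρ - 1)) =ᶠ[nhds x] fun _ ↦ (1 : ℝ) := by
      filter_upwards [Ioi_mem_nhds hx] with y hy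
      exact chi_eq_one (le_of_lt hy)
    rw [hev.deriv_eq, deriv_const]

/-! ### The soft clamp `clamp_ε(ρ) = (1 - ε) + (ε/2) h((ρ - (1 - ε))/(ε/2))` -/

/-- `clamp_ε = 1 - ε` on `ρ ≤ 1 - ε`. [folklore] -/
theorem clamp_of_le {ε ρ : ℝ} (hε : 0 < ε) (hρ : ρ ≤ 1 - ε) :
    (1 - ε) + ε / 2 * ((ρ - (1 - ε)) / (ε / 2) * smoothTransition ((ρ - (1 - ε)) / (ε / 2))) =
      1 - ε := by
  rw [mul_smoothTransition_of_nonpos (div_nonpos_of_nonpos_of_nonneg (by linarith) (by linarith)),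
    mul_zero, add_zero]

/-- `clamp_ε(ρ) = ρ` on `1 - ε/2 ≤ ρ`. [folklore] -/
theorem clamp_of_ge {ε ρ : ℝ} (hε : 0 < ε) (hρ : 1 - ε / 2 ≤ ρ) :
    (1 - ε) + ε / 2 * ((ρ - (1 - ε)) / (ε / 2) * smoothTransition ((ρ - (1 - ε)) / (ε / 2))) = ρ := by
  have hε2 : 0 < ε / 2 := by linarith
  rw [mul_smoothTransition_of_one_le ((one_le_div hε2).2 (by linarith))]
  field_simp
  ring

/-- `1 - ε ≤ clamp_ε(ρ)`. [folklore] -/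
theorem le_clamp {ε : ℝ} (hε : 0 < ε) (ρ : ℝ) :
    1 - ε ≤ (1 - ε) + ε / 2 * ((ρ - (1 - ε)) / (ε / 2) * smoothTransition ((ρ - (1 - ε)) / (ε / 2))) :=
  le_add_of_nonneg_right (mul_nonneg (by linarith) (mul_smoothTransition_nonneg _))

/-- `clamp_ε(ρ) ≤ ρ` for `1 - ε ≤ ρ`. [folklore] -/
theorem clamp_le_self {ε ρ : ℝ} (hε : 0 < ε) (hρ : 1 - ε ≤ ρ) :
    (1 - ε) + ε / 2 * ((ρ - (1 - ε)) / (ε / 2) * smoothTransition ((ρ - (1 - ε)) / (ε / 2))) ≤ ρ := by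
  have hε2 : 0 < ε / 2 := by linarith
  have hx : 0 ≤ (ρ - (1 - ε)) / (ε / 2) := div_nonneg (by linarith) hε2.le
  have h := mul_smoothTransition_le_self hx
  calc (1 - ε) + ε / 2 * ((ρ - (1 - ε)) / (ε / 2) * smoothTransition ((ρ - (1 - ε)) / (ε / 2)))
      ≤ (1 - ε) + ε / 2 * ((ρ - (1 - ε)) / (ε / 2)) := by
        have := mul_le_mul_of_nonneg_left h hε2.le
        linarith
    _ = ρ := by field_simp; ring

/-- `clamp_ε` is monotone. [folklore] -/
theorem monotone_clamp {ε : ℝ} (hε : 0 < ε) :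
    Monotone fun ρ : ℝ ↦
      (1 - ε) + ε / 2 * ((ρ - (1 - ε)) / (ε / 2) * smoothTransition ((ρ - (1 - ε)) / (ε / 2))) := by
  intro x y hxy
  have hε2 : 0 < ε / 2 := by linarith
  have h := monotone_mul_smoothTransition
    (div_le_div_of_nonneg_right (c := ε / 2) (by linarith : x - (1 - ε) ≤ y - (1 - ε)) hε2.le)
  have h2 := mul_le_mul_of_nonneg_left h hε2.le
  simp only at h2 ⊢
  linarith

/-- `clamp_ε` is smooth. [folklore] -/
theorem contDiff_clamp {ε : ℝ} {n : ℕ∞} :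
    ContDiff ℝ n fun ρ : ℝ ↦
      (1 - ε) + ε / 2 * ((ρ - (1 - ε)) / (ε / 2) * smoothTransition ((ρ - (1 - ε)) / (ε / 2))) := by
  have h1 : ContDiff ℝ n fun ρ : ℝ ↦ (ρ - (1 - ε)) / (ε / 2) :=
    (contDiff_id.sub contDiff_const).div_const _
  exact contDiff_const.add (contDiff_const.mul (contDiff_mul_smoothTransition.comp h1))

end Literature.Geometry.Riemannian

end
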